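import Literature.MathematicalPhysics.QuantumFieldTheory.Balaban1983to89.T4BetaFlowWellPosed

/-!
# EriceRemainderEnclosureHistoryAutonomyWellPosed — (E37b) THE FLOW WITH MEMORY IS WELL-POSED UNDER THE ZEROTH AGE-MOMENT ALONE:
# `T4BetaFlowWellPosed` §§3–4 (stability, uniqueness, Lipschitz dependence on pin and functional, existence by Picard iteration) with
# the geometric `MemoryProfile Cm θ γ B` REPLACED by `|B u − B u′| ≤ M·D` whenever the box histories are entrywise `D`-close — the
# ZEROTH MOMENT `M` of the memory, no profile, no rate — and the smallness `Cm·γ < b(1−θ)` by `M·γ < b` (node U2's case is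
# `M = Cm∕(1−θ)`: the rate `θ` is IDLE for well-posedness)

Cell `pub-balaban`, β-function sub-cell, BINDER row D4 «RemainderConst leaves for Bałaban's split» (`HOME/BINDER-OWNERS.md`; owner
lineage `b2b-balaban-beta-an4`; this file by co-owner #2 lineage `b2b-balaban-beta-d4-p2`, generation 39), β-FLOW TEAM duty (1),
FREEZE (0) honoured (def-free; the zeroth-moment modulus is an INLINE hypothesis on the functional `B`, never a `def`; node U2's
`MemFlow`, `drive`, `picard`, `iterate`, `solution` and every profile-free lemma of `T4BetaFlowWellPosed` §§1–2 are used BY NAME, nothing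
restated).  Companion of (E37a) `EriceRemainderEnclosureHistoryAutonomy` (the identification `MemFlow (betaInf β) g_IR (gstar g)` needs no
memory hypothesis) and (E37c) `EriceRemainderEnclosureHistoryAutonomyEnd` (rows of `HistLipschitz` ARE the zeroth moment of `betaInf β`;
the intrinsic characterisation of the continuum running coupling under (E33)'s rows-only class).  Imports node U2's `T4BetaFlowWellPosed` only.

HONEST FRAMING (page 1, verbatim and binding).  *"Discharging BetaPertH makes Bałaban's UV stability UNCONDITIONAL — a real
constructive-QFT result; it is NOT the continuum limit and NOT the Clay problem."*  THIS FILE DISCHARGES NOTHING OF THE KIND.  It is pure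
real analysis about an ABSTRACT functional `B : (ℕ → ℝ) → ℝ` on box-valued reversed histories with a displayed sup-Lipschitz modulus `M`
and a displayed lower bound `b > 0` (the shape of (0.31)'s lower half) — hypotheses, not facts; which modulus Bałaban's limit functional
has is NOT PRINTED ([I] p. 298: the dependence on the preceding couplings exists, qualitatively) and not asserted.  Row D4 class
UNCHANGED (critical-path width 0; instance 0∕1; D4 DISCHARGE NO DATE).  HONEST DEPENDENCY: continuum YM on T⁴ ⇐ BetaPertH ∧ nine
spine estimates (0/9 proved); BetaPertH ⇐ (D1) ∧ (D4) ∧ CAP+tail; G-an2-4 gates asym, D1 and NE2/3/4.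

THE POINT (census sense (α); the AUTONOMY row of the history channel, second half).  Node U2's `T4BetaFlowWellPosed` solves the continuum
flow with memory `1∕h(m+1)² = 1∕h(m)² + B(h(m+1), h(m+2), …)`, `h 0 = g_IR`, on the box under `MemoryProfile Cm θ γ B` and `Cm·γ < b(1−θ)`
(its §9 header already calls that `hsmall` a zeroth-moment criterion).  THIS FILE makes the reading the THEOREM: the profile enters §§3–4
there only through `abs_sub_shift_le` (`≤ Cm·D∕(1−θ)` for entrywise `D`-close histories), i.e. through the ZEROTH MOMENT `M = Cm∕(1−θ)`; with
`hB : ∀ u u′, SeqBox γ u → SeqBox γ u′ → ∀ D, (∀ j, |u j − u′ j| ≤ D) → |B u − B u′| ≤ M·D` in place of the profile the core estimate reads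
`|picard B gIR h m − a′| ≤ γ³·|1∕gIR² − 1∕gIR′²| + (γ∕b)·η + (M·γ∕b)·D` (§2), the solution map is an `M·γ∕b`-contraction in the supremum
distance, and under `M·γ < b` all of §4 there follows VERBATIM (§3); §4 recovers node U2's hypothesis as the special case.  Census: at the
AUTONOMY row the decay of the memory buys NOTHING for well-posedness — the threshold is the zeroth moment `M·γ < b`, the currency and degree
of (E32)'s lattice two-run uniqueness; sharp in KIND by node U2's `Sharpness.memFlow_unique_false_without_hsmall` (Markov bump,
`M·γ∕b = 10`).  NOT claimed: a floor-FREE statement (node U2's §9: the FIRST moment decides there); anything about Bałaban's (1.22).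

WHAT IS PROVED ([folklore]; 0 `def`, 0 sorry; suffix `_zm` = «zeroth moment»).  §1 `le_upper_zm`, `lower_le_upper_zm`, `drive_le_mul_upper_zm`,
`le_picard_zm`.  §2 `abs_sub_shift_le_zm`, `abs_drive_sub_drive_le_zm`, **`abs_picard_sub_le_core_zm`**, `abs_picard_sub_picard_le_zm`,
**`picard_contraction_zm`**, `contraction_const_nonneg_zm` ∕ `_lt_one_zm`.  §3 **`memFlow_stability_zm`** (pin-Lipschitz = the case `η = 0`),
**`memFlow_unique_zm`**, `memFlow_lipschitz_functional_zm`, `memFlow_eq_of_functional_agree_zm`, `abs_iterate_succ_sub_le_zm`, `tendsto_iterate_zm`,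
`abs_iterate_sub_solution_le_zm`, `solution_seqBox_zm`, `picard_solution_zm`, **`memFlow_solution_zm`**, **`existsUnique_memFlow_zm`**,
`eq_solution_of_memFlow_zm`.  §4 `zerothMoment_of_memoryProfile`.
-/

noncomputable section
open Filter Topology Finset

namespace Summit.QuantumFields.BalabanUV.Beta.EriceRemainderEnclosureHistoryAutonomyWellPosed

open Literature.MathematicalPhysics.QuantumFieldTheory.Balaban1983to89
open Literature.MathematicalPhysics.QuantumFieldTheory.Balaban1983to89.T4CouplingMatching (abs_sub_le_of_inv_sq)
open Literature.MathematicalPhysics.QuantumFieldTheory.Balaban1983to89.T4ContinuumCoupling (tendsto_of_abs_sub_le_geom)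
open Literature.MathematicalPhysics.QuantumFieldTheory.Balaban1983to89.T4BetaStationary
open Literature.MathematicalPhysics.QuantumFieldTheory.Balaban1983to89.T4BetaFlowWellPosed

variable {B B' : (ℕ → ℝ) → ℝ} {M γ b η gIR gIR' : ℝ} {h h' : ℕ → ℝ}

/-! ## §1 The zeroth age-moment bounds the functional and the driving sums on the box -/

/-- THE UPPER VALUE under the zeroth moment: `B h ≤ B(γ, γ, …) + M·γ` on the box. [folklore] -/
theorem le_upper_zm
    (hB : ∀ u u' : ℕ → ℝ, SeqBox γ u → SeqBox γ u' → ∀ D : ℝ, (∀ j, |u j - u' j| ≤ D) → |B u - B u'| ≤ M * D)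
    (hγ : 0 < γ) (hh : SeqBox γ h) : B h ≤ B (fun _ => γ) + M * γ := by
  have h1 := hB h _ hh (seqBox_const hγ) γ fun j => abs_sub_le_of_seqBox hh (seqBox_const hγ) j
  have := (abs_sub_le_iff.mp h1).1
  linarith

/-- A lower bound of the functional on the box is below the upper value. [folklore] -/
theorem lower_le_upper_zm (hM : 0 ≤ M) (hγ : 0 < γ) (hlo : ∀ u, SeqBox γ u → b ≤ B u) :
    b ≤ B (fun _ => γ) + M * γ := by
  nlinarith [hlo _ (seqBox_const hγ), mul_nonneg hM hγ.le]

/-- Upper side of the driving sums: `drive B h m ≤ m·(B(γ,…) + M·γ)` on the box. [folklore] -/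
theorem drive_le_mul_upper_zm
    (hB : ∀ u u' : ℕ → ℝ, SeqBox γ u → SeqBox γ u' → ∀ D : ℝ, (∀ j, |u j - u' j| ≤ D) → |B u - B u'| ≤ M * D)
    (hγ : 0 < γ) (hh : SeqBox γ h) : ∀ m : ℕ, drive B h m ≤ (m : ℝ) * (B (fun _ => γ) + M * γ) := by
  intro m
  induction m with
  | zero => simp
  | succ m ih =>
    rw [drive_succ, Nat.cast_succ, add_mul, one_mul]
    exact add_le_add ih (le_upper_zm hB hγ (seqBox_shift hh (m + 1)))

/-- Lower side of the solution map: `1∕√(1∕gIR² + m·(B(γ,…) + M·γ)) ≤ picard B gIR h m`. [folklore] -/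
theorem le_picard_zm
    (hB : ∀ u u' : ℕ → ℝ, SeqBox γ u → SeqBox γ u' → ∀ D : ℝ, (∀ j, |u j - u' j| ≤ D) → |B u - B u'| ≤ M * D)
    (hγ : 0 < γ) (hgIR : 0 < gIR) (hb : 0 < b) (hlo : ∀ u, SeqBox γ u → b ≤ B u) (hh : SeqBox γ h) (m : ℕ) :
    1 / Real.sqrt (1 / gIR ^ 2 + (m : ℝ) * (B (fun _ => γ) + M * γ)) ≤ picard B gIR h m :=
  one_div_sqrt_anti (base_pos hgIR hb hlo hh m) (add_le_add le_rfl (drive_le_mul_upper_zm hB hγ hh m))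

/-! ## §2 The contraction under the zeroth moment -/

/-- ONE MEMORY TERM: entrywise `D`-close box histories have `M·D`-close shifted values. [folklore] -/
theorem abs_sub_shift_le_zm
    (hB : ∀ u u' : ℕ → ℝ, SeqBox γ u → SeqBox γ u' → ∀ D : ℝ, (∀ j, |u j - u' j| ≤ D) → |B u - B u'| ≤ M * D)
    (hh : SeqBox γ h) (hh' : SeqBox γ h') {D : ℝ} (hD : ∀ i, |h i - h' i| ≤ D) (n : ℕ) :
    |B (fun j => h (n + j)) - B (fun j => h' (n + j))| ≤ M * D :=
  hB _ _ (seqBox_shift hh n) (seqBox_shift hh' n) D fun j => hD (n + j)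

/-- THE DRIVING SUMS of `B` (zeroth moment `M`) and `B′` (within `η` of `B`) on entrywise `D`-close box histories: `≤ m·(M·D + η)`. [folklore] -/
theorem abs_drive_sub_drive_le_zm
    (hB : ∀ u u' : ℕ → ℝ, SeqBox γ u → SeqBox γ u' → ∀ D : ℝ, (∀ j, |u j - u' j| ≤ D) → |B u - B u'| ≤ M * D)
    (hη : ∀ u, SeqBox γ u → |B u - B' u| ≤ η) (hh : SeqBox γ h) (hh' : SeqBox γ h') {D : ℝ}
    (hD : ∀ i, |h i - h' i| ≤ D) (m : ℕ) :
    |drive B h m - drive B' h' m| ≤ (m : ℝ) * (M * D + η) := by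
  unfold drive
  rw [← sum_sub_distrib]
  refine (abs_sum_le_sum_abs _ _).trans ?_
  have hterm : ∀ l ∈ range m, |B (fun j => h (l + 1 + j)) - B' (fun j => h' (l + 1 + j))| ≤ M * D + η := by
    intro l _
    have h1 := abs_sub_shift_le_zm hB hh hh' hD (l + 1)
    have h2 := hη _ (seqBox_shift hh' (l + 1))
    calc |B (fun j => h (l + 1 + j)) - B' (fun j => h' (l + 1 + j))|
        = |(B (fun j => h (l + 1 + j)) - B (fun j => h' (l + 1 + j)))
            + (B (fun j => h' (l + 1 + j)) - B' (fun j => h' (l + 1 + j)))| := by ring_nf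
      _ ≤ |B (fun j => h (l + 1 + j)) - B (fun j => h' (l + 1 + j))|
            + |B (fun j => h' (l + 1 + j)) - B' (fun j => h' (l + 1 + j))| := abs_add_le _ _
      _ ≤ M * D + η := add_le_add h1 h2
  calc ∑ l ∈ range m, |B (fun j => h (l + 1 + j)) - B' (fun j => h' (l + 1 + j))|
      ≤ ∑ l ∈ range m, (M * D + η) := sum_le_sum hterm
    _ = (m : ℝ) * (M * D + η) := by rw [sum_const, card_range, nsmul_eq_mul]

/-- **THE CORE ESTIMATE UNDER THE ZEROTH MOMENT.**  `B` with zeroth moment `M ≥ 0` and lower bound `b > 0` on the box `]0,γ]^ℕ`, pin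
`gIR ∈ ]0,γ]`, a box history `h`; on the other side ANY functional `B′` within `η` of `B` on the box, any pin `gIR′`, any box history `h′`
and any value `a′ ∈ ]0,γ]` with `1∕a′² = 1∕gIR′² + drive B′ h′ m`.  If `h, h′` are entrywise `D`-close then
`|picard B gIR h m − a′| ≤ γ³·|1∕gIR² − 1∕gIR′²| + (γ∕b)·η + (M·γ∕b)·D` — node U2's `abs_picard_sub_le_core` with `Cm∕(1−θ) ↦ M`, same two
absorptions (`1∕(1∕gIR² + m b) ≤ γ²`, `m∕(1∕gIR² + m b) ≤ 1∕b`). [folklore] -/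
theorem abs_picard_sub_le_core_zm
    (hB : ∀ u u' : ℕ → ℝ, SeqBox γ u → SeqBox γ u' → ∀ D : ℝ, (∀ j, |u j - u' j| ≤ D) → |B u - B u'| ≤ M * D)
    (hM : 0 ≤ M) (hgIR : 0 < gIR) (hgIRγ : gIR ≤ γ) (hb : 0 < b) (hlo : ∀ u, SeqBox γ u → b ≤ B u)
    (hη : ∀ u, SeqBox γ u → |B u - B' u| ≤ η) (hh : SeqBox γ h) (hh' : SeqBox γ h') {D : ℝ}
    (hD : ∀ i, |h i - h' i| ≤ D) (m : ℕ) {a' : ℝ} (ha' : 0 < a') (ha'γ : a' ≤ γ)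
    (hSa' : 1 / a' ^ 2 = 1 / gIR' ^ 2 + drive B' h' m) :
    |picard B gIR h m - a'| ≤ γ ^ 3 * |1 / gIR ^ 2 - 1 / gIR' ^ 2| + γ / b * η + M * γ / b * D := by
  have hγ : 0 < γ := lt_of_lt_of_le hgIR hgIRγ
  have hη0 : 0 ≤ η := (abs_nonneg _).trans (hη _ (seqBox_const hγ))
  have hD0 : 0 ≤ D := (abs_nonneg _).trans (hD 0)
  set a := picard B gIR h m with ha_def
  have ha : 0 < a := picard_pos hgIR hb hlo hh m
  have hSa : 1 / a ^ 2 = 1 / gIR ^ 2 + drive B h m := one_div_picard_sq hgIR hb hlo hh m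
  have ha2 : a ^ 2 ≤ 1 / (1 / gIR ^ 2 + (m : ℝ) * b) := picard_sq_le hgIR hb hlo hh m
  have hW0 : 0 < 1 / (1 / gIR ^ 2 + (m : ℝ) * b) := by positivity
  have hw := abs_sub_le_of_inv_sq ha ha'
  have hdiff : |1 / a ^ 2 - 1 / a' ^ 2| ≤ |1 / gIR ^ 2 - 1 / gIR' ^ 2| + (m : ℝ) * (M * D + η) := by
    rw [hSa, hSa']
    calc |1 / gIR ^ 2 + drive B h m - (1 / gIR' ^ 2 + drive B' h' m)|
        = |(1 / gIR ^ 2 - 1 / gIR' ^ 2) + (drive B h m - drive B' h' m)| := by ring_nf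
      _ ≤ |1 / gIR ^ 2 - 1 / gIR' ^ 2| + |drive B h m - drive B' h' m| := abs_add_le _ _
      _ ≤ |1 / gIR ^ 2 - 1 / gIR' ^ 2| + (m : ℝ) * (M * D + η) :=
          add_le_add le_rfl (abs_drive_sub_drive_le_zm hB hη hh hh' hD m)
  have hweight : a ^ 2 * a' ≤ 1 / (1 / gIR ^ 2 + (m : ℝ) * b) * γ := mul_le_mul ha2 ha'γ ha'.le hW0.le
  have hΔ0 : 0 ≤ |1 / gIR ^ 2 - 1 / gIR' ^ 2| + (m : ℝ) * (M * D + η) := by positivity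
  have step1 : |a - a'| ≤ 1 / (1 / gIR ^ 2 + (m : ℝ) * b) * γ
      * (|1 / gIR ^ 2 - 1 / gIR' ^ 2| + (m : ℝ) * (M * D + η)) :=
    hw.trans (mul_le_mul hweight hdiff (abs_nonneg _) (by positivity))
  have hA1 : 1 / (1 / gIR ^ 2 + (m : ℝ) * b) ≤ γ ^ 2 := by
    have h2 := one_div_le_one_div_of_le (by positivity)
      (le_add_of_nonneg_right (by positivity) : 1 / gIR ^ 2 ≤ 1 / gIR ^ 2 + (m : ℝ) * b)
    rw [one_div_one_div] at h2
    exact h2.trans (pow_le_pow_left₀ hgIR.le hgIRγ 2)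
  have hA2 := mul_one_div_base_le hgIR hb m
  have e : 1 / (1 / gIR ^ 2 + (m : ℝ) * b) * γ * (|1 / gIR ^ 2 - 1 / gIR' ^ 2| + (m : ℝ) * (M * D + η))
      = (1 / (1 / gIR ^ 2 + (m : ℝ) * b)) * (γ * |1 / gIR ^ 2 - 1 / gIR' ^ 2|)
        + ((m : ℝ) * (1 / (1 / gIR ^ 2 + (m : ℝ) * b))) * (γ * (M * D + η)) := by ring
  rw [e] at step1
  have t1 : (1 / (1 / gIR ^ 2 + (m : ℝ) * b)) * (γ * |1 / gIR ^ 2 - 1 / gIR' ^ 2|)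
      ≤ γ ^ 2 * (γ * |1 / gIR ^ 2 - 1 / gIR' ^ 2|) := mul_le_mul_of_nonneg_right hA1 (by positivity)
  have t2 : ((m : ℝ) * (1 / (1 / gIR ^ 2 + (m : ℝ) * b))) * (γ * (M * D + η))
      ≤ 1 / b * (γ * (M * D + η)) := mul_le_mul_of_nonneg_right hA2 (by positivity)
  have e2 : γ ^ 2 * (γ * |1 / gIR ^ 2 - 1 / gIR' ^ 2|) + 1 / b * (γ * (M * D + η))
      = γ ^ 3 * |1 / gIR ^ 2 - 1 / gIR' ^ 2| + γ / b * η + M * γ / b * D := by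
    field_simp; ring
  calc |a - a'| ≤ _ := step1
    _ ≤ γ ^ 2 * (γ * |1 / gIR ^ 2 - 1 / gIR' ^ 2|) + 1 / b * (γ * (M * D + η)) := add_le_add t1 t2
    _ = _ := e2

/-- The core estimate for the solution map itself (same functional, two pins, two box histories):
`|picard B gIR h m − picard B gIR′ h′ m| ≤ γ³·|1∕gIR² − 1∕gIR′²| + (M·γ∕b)·D`. [folklore] -/
theorem abs_picard_sub_picard_le_zm
    (hB : ∀ u u' : ℕ → ℝ, SeqBox γ u → SeqBox γ u' → ∀ D : ℝ, (∀ j, |u j - u' j| ≤ D) → |B u - B u'| ≤ M * D)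
    (hM : 0 ≤ M) (hgIR : 0 < gIR) (hgIRγ : gIR ≤ γ) (hgIR' : 0 < gIR') (hgIR'γ : gIR' ≤ γ) (hb : 0 < b)
    (hlo : ∀ u, SeqBox γ u → b ≤ B u) (hh : SeqBox γ h) (hh' : SeqBox γ h') {D : ℝ}
    (hD : ∀ i, |h i - h' i| ≤ D) (m : ℕ) :
    |picard B gIR h m - picard B gIR' h' m| ≤ γ ^ 3 * |1 / gIR ^ 2 - 1 / gIR' ^ 2| + M * γ / b * D := by
  have h0 : ∀ u, SeqBox γ u → |B u - B u| ≤ 0 := fun u _ => by simp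
  have := abs_picard_sub_le_core_zm hB hM hgIR hgIRγ hb hlo h0 hh hh' hD m
    (picard_pos hgIR' hb hlo hh' m) ((picard_le_pin hgIR' hb hlo hh' m).trans hgIR'γ)
    (one_div_picard_sq hgIR' hb hlo hh' m)
  simpa using this

/-- **THE SOLUTION MAP IS A `q`-CONTRACTION IN THE SUPREMUM DISTANCE ON THE BOX, `q = M·γ∕b`.** [folklore] -/
theorem picard_contraction_zm
    (hB : ∀ u u' : ℕ → ℝ, SeqBox γ u → SeqBox γ u' → ∀ D : ℝ, (∀ j, |u j - u' j| ≤ D) → |B u - B u'| ≤ M * D)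
    (hM : 0 ≤ M) (hgIR : 0 < gIR) (hgIRγ : gIR ≤ γ) (hb : 0 < b) (hlo : ∀ u, SeqBox γ u → b ≤ B u) (hh : SeqBox γ h)
    (hh' : SeqBox γ h') {D : ℝ} (hD : ∀ i, |h i - h' i| ≤ D) (m : ℕ) :
    |picard B gIR h m - picard B gIR h' m| ≤ M * γ / b * D := by
  simpa using abs_picard_sub_picard_le_zm hB hM hgIR hgIRγ hgIR hgIRγ hb hlo hh hh' hD m

/-- The contraction constant is nonnegative … [folklore] -/
theorem contraction_const_nonneg_zm (hM : 0 ≤ M) (hγ : 0 ≤ γ) (hb : 0 < b) : 0 ≤ M * γ / b := div_nonneg (mul_nonneg hM hγ) hb.le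

/-- … and below one exactly under the smallness `M·γ < b`. [folklore] -/
theorem contraction_const_lt_one_zm (hb : 0 < b) (hsmall : M * γ < b) : M * γ / b < 1 := (div_lt_one hb).mpr hsmall

/-! ## §3 Well-posedness under `M·γ < b`: stability, uniqueness, existence -/

/-- **STABILITY (the master estimate) UNDER THE ZEROTH MOMENT.**  `B` with zeroth moment `M ≥ 0` and lower bound `b > 0` on the box,
smallness `M·γ < b`; `B′` ANY functional within `η` of `B` on the box.  A box solution `h` of the `B`-flow from `gIR` and ANY box solution `h′`
of the `B′`-flow from `gIR′` satisfy, at EVERY scale, `|h m − h′ m| ≤ (γ³·|1∕gIR² − 1∕gIR′²| + (γ∕b)·η) ∕ (1 − M·γ∕b)`. [folklore] -/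
theorem memFlow_stability_zm
    (hB : ∀ u u' : ℕ → ℝ, SeqBox γ u → SeqBox γ u' → ∀ D : ℝ, (∀ j, |u j - u' j| ≤ D) → |B u - B u'| ≤ M * D)
    (hM : 0 ≤ M) (hgIR : 0 < gIR) (hgIRγ : gIR ≤ γ) (hb : 0 < b) (hlo : ∀ u, SeqBox γ u → b ≤ B u)
    (hsmall : M * γ < b) (hη : ∀ u, SeqBox γ u → |B u - B' u| ≤ η)
    (hh : SeqBox γ h) (hh' : SeqBox γ h') (hf : MemFlow B gIR h) (hf' : MemFlow B' gIR' h') (m : ℕ) :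
    |h m - h' m| ≤ (γ ^ 3 * |1 / gIR ^ 2 - 1 / gIR' ^ 2| + γ / b * η) / (1 - M * γ / b) := by
  have hγ : 0 < γ := lt_of_lt_of_le hgIR hgIRγ
  have hη0 : 0 ≤ η := (abs_nonneg _).trans (hη _ (seqBox_const hγ))
  refine le_of_affine_contraction (δ := fun i => |h i - h' i|)
    (contraction_const_nonneg_zm hM hγ.le hb) (contraction_const_lt_one_zm hb hsmall) (by positivity)
    (fun i => abs_sub_le_of_seqBox hh hh' i) (fun D hD i => ?_) m
  have hfix := picard_eq_of_memFlow hf (fun m => (hh m).1)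
  have := abs_picard_sub_le_core_zm hB hM hgIR hgIRγ hb hlo hη hh hh' hD i (hh' i).1 (hh' i).2
    (invSq_eq_of_memFlow hf' i)
  rw [hfix] at this
  linarith

/-- **UNIQUENESS UNDER THE ZEROTH MOMENT.**  Under `M·γ < b` two box solutions with the same pin coincide at every scale: a sup-Lipschitz
memory of total strength `M`, however distributed over the ages, determines the trajectory. [folklore] -/
theorem memFlow_unique_zm
    (hB : ∀ u u' : ℕ → ℝ, SeqBox γ u → SeqBox γ u' → ∀ D : ℝ, (∀ j, |u j - u' j| ≤ D) → |B u - B u'| ≤ M * D)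
    (hM : 0 ≤ M) (hgIR : 0 < gIR) (hgIRγ : gIR ≤ γ) (hb : 0 < b) (hlo : ∀ u, SeqBox γ u → b ≤ B u)
    (hsmall : M * γ < b) (hh : SeqBox γ h) (hh' : SeqBox γ h') (hf : MemFlow B gIR h)
    (hf' : MemFlow B gIR h') : h = h' := by
  funext m
  have := memFlow_stability_zm hB hM hgIR hgIRγ hb hlo hsmall (fun u _ => by simp : ∀ u, SeqBox γ u → |B u - B u| ≤ 0)
    hh hh' hf hf' m
  simp only [sub_self, abs_zero, mul_zero, zero_add, zero_div] at this
  exact eq_of_abs_sub_nonpos this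

/-- **LIPSCHITZ DEPENDENCE ON THE FUNCTIONAL**, uniformly in the scale: same pin, `B′` within `η` of `B` on the box ⟹
`|h m − h′ m| ≤ (γ∕b)∕(1−q)·η` for ANY box solution `h′` of the `B′`-flow. [folklore] -/
theorem memFlow_lipschitz_functional_zm
    (hB : ∀ u u' : ℕ → ℝ, SeqBox γ u → SeqBox γ u' → ∀ D : ℝ, (∀ j, |u j - u' j| ≤ D) → |B u - B u'| ≤ M * D)
    (hM : 0 ≤ M) (hgIR : 0 < gIR) (hgIRγ : gIR ≤ γ) (hb : 0 < b) (hlo : ∀ u, SeqBox γ u → b ≤ B u)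
    (hsmall : M * γ < b) (hη : ∀ u, SeqBox γ u → |B u - B' u| ≤ η)
    (hh : SeqBox γ h) (hh' : SeqBox γ h') (hf : MemFlow B gIR h) (hf' : MemFlow B' gIR h') (m : ℕ) :
    |h m - h' m| ≤ γ / b / (1 - M * γ / b) * η := by
  have := memFlow_stability_zm hB hM hgIR hgIRγ hb hlo hsmall hη hh hh' hf hf' m
  simp only [sub_self, abs_zero, mul_zero, zero_add] at this
  rw [div_mul_eq_mul_div]
  exact this

/-- **UNIVERSALITY**: two functionals that AGREE on the box generate the same box solution from the same pin. [folklore] -/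
theorem memFlow_eq_of_functional_agree_zm
    (hB : ∀ u u' : ℕ → ℝ, SeqBox γ u → SeqBox γ u' → ∀ D : ℝ, (∀ j, |u j - u' j| ≤ D) → |B u - B u'| ≤ M * D)
    (hM : 0 ≤ M) (hgIR : 0 < gIR) (hgIRγ : gIR ≤ γ) (hb : 0 < b) (hlo : ∀ u, SeqBox γ u → b ≤ B u)
    (hsmall : M * γ < b) (hagree : ∀ u, SeqBox γ u → B u = B' u) (hh : SeqBox γ h)
    (hh' : SeqBox γ h') (hf : MemFlow B gIR h) (hf' : MemFlow B' gIR h') : h = h' := by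
  funext m
  have h0 : ∀ u, SeqBox γ u → |B u - B' u| ≤ 0 := fun u hu => by simp [hagree u hu]
  have := memFlow_lipschitz_functional_zm hB hM hgIR hgIRγ hb hlo hsmall h0 hh hh' hf hf' m
  rw [mul_zero] at this
  exact eq_of_abs_sub_nonpos this

/-- CONSECUTIVE PICARD ITERATES (node U2's `iterate B gIR`, from the constant history) ARE `γ·qⁿ`-CLOSE, uniformly in the scale. [folklore] -/
theorem abs_iterate_succ_sub_le_zm
    (hB : ∀ u u' : ℕ → ℝ, SeqBox γ u → SeqBox γ u' → ∀ D : ℝ, (∀ j, |u j - u' j| ≤ D) → |B u - B u'| ≤ M * D)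
    (hM : 0 ≤ M) (hgIR : 0 < gIR) (hgIRγ : gIR ≤ γ) (hb : 0 < b) (hlo : ∀ u, SeqBox γ u → b ≤ B u) :
    ∀ n m, |iterate B gIR (n + 1) m - iterate B gIR n m| ≤ γ * (M * γ / b) ^ n := by
  intro n
  induction n with
  | zero =>
    intro m
    simpa using abs_sub_le_of_seqBox (iterate_seqBox hgIR hgIRγ hb hlo 1) (iterate_seqBox hgIR hgIRγ hb hlo 0) m
  | succ n ih =>
    intro m
    have := picard_contraction_zm hB hM hgIR hgIRγ hb hlo (iterate_seqBox hgIR hgIRγ hb hlo (n + 1))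
      (iterate_seqBox hgIR hgIRγ hb hlo n) ih m
    calc |iterate B gIR (n + 1 + 1) m - iterate B gIR (n + 1) m|
        = |picard B gIR (iterate B gIR (n + 1)) m - picard B gIR (iterate B gIR n) m| := rfl
      _ ≤ M * γ / b * (γ * (M * γ / b) ^ n) := this
      _ = γ * (M * γ / b) ^ (n + 1) := by ring

/-- The iterates converge scale-wise to node U2's `solution B gIR` (ℝ complete; `cauchySeq_of_le_geometric`). [folklore] -/
theorem tendsto_iterate_zm
    (hB : ∀ u u' : ℕ → ℝ, SeqBox γ u → SeqBox γ u' → ∀ D : ℝ, (∀ j, |u j - u' j| ≤ D) → |B u - B u'| ≤ M * D)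
    (hM : 0 ≤ M) (hgIR : 0 < gIR) (hgIRγ : gIR ≤ γ) (hb : 0 < b) (hlo : ∀ u, SeqBox γ u → b ≤ B u)
    (hsmall : M * γ < b) (m : ℕ) :
    Tendsto (fun n => iterate B gIR n m) atTop (𝓝 (solution B gIR m)) := by
  have hc : CauchySeq fun n => iterate B gIR n m := by
    refine cauchySeq_of_le_geometric (M * γ / b) γ (contraction_const_lt_one_zm hb hsmall) fun n => ?_
    rw [Real.dist_eq, abs_sub_comm]
    exact abs_iterate_succ_sub_le_zm hB hM hgIR hgIRγ hb hlo n m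
  exact tendsto_nhds_limUnder (cauchySeq_tendsto_of_complete hc)

/-- GEOMETRIC RATE of the scale-wise convergence: `|iterate n m − solution m| ≤ γqⁿ∕(1−q)`. [folklore] -/
theorem abs_iterate_sub_solution_le_zm
    (hB : ∀ u u' : ℕ → ℝ, SeqBox γ u → SeqBox γ u' → ∀ D : ℝ, (∀ j, |u j - u' j| ≤ D) → |B u - B u'| ≤ M * D)
    (hM : 0 ≤ M) (hgIR : 0 < gIR) (hgIRγ : gIR ≤ γ) (hb : 0 < b) (hlo : ∀ u, SeqBox γ u → b ≤ B u)
    (hsmall : M * γ < b) (n m : ℕ) :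
    |iterate B gIR n m - solution B gIR m| ≤ γ * (M * γ / b) ^ n / (1 - M * γ / b) := by
  have h := dist_le_of_le_geometric_of_tendsto (M * γ / b) γ (contraction_const_lt_one_zm hb hsmall)
    (fun n => by
      rw [Real.dist_eq, abs_sub_comm]
      exact abs_iterate_succ_sub_le_zm hB hM hgIR hgIRγ hb hlo n m)
    (tendsto_iterate_zm hB hM hgIR hgIRγ hb hlo hsmall m) n
  rwa [Real.dist_eq] at h

/-- The scale-wise limit is box-valued. [folklore] -/
theorem solution_seqBox_zm
    (hB : ∀ u u' : ℕ → ℝ, SeqBox γ u → SeqBox γ u' → ∀ D : ℝ, (∀ j, |u j - u' j| ≤ D) → |B u - B u'| ≤ M * D)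
    (hM : 0 ≤ M) (hgIR : 0 < gIR) (hgIRγ : gIR ≤ γ) (hb : 0 < b) (hlo : ∀ u, SeqBox γ u → b ≤ B u)
    (hsmall : M * γ < b) : SeqBox γ (solution B gIR) := by
  have hγ : 0 < γ := lt_of_lt_of_le hgIR hgIRγ
  intro m
  have ht := tendsto_iterate_zm hB hM hgIR hgIRγ hb hlo hsmall m
  have hup : b ≤ B (fun _ => γ) + M * γ := lower_le_upper_zm hM hγ hlo
  have hbb : 0 < 1 / gIR ^ 2 + (m : ℝ) * (B (fun _ => γ) + M * γ) := by
    have : 0 ≤ (m : ℝ) * (B (fun _ => γ) + M * γ) := mul_nonneg (Nat.cast_nonneg m) (hb.le.trans hup)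
    positivity
  have hlow : ∀ n, 1 / Real.sqrt (1 / gIR ^ 2 + (m : ℝ) * (B (fun _ => γ) + M * γ)) ≤ iterate B gIR n m := by
    intro n
    cases n with
    | zero =>
      simp only [iterate_zero]
      refine one_div_sqrt_le hgIR (le_add_of_nonneg_right ?_)
      exact mul_nonneg (Nat.cast_nonneg m) (hb.le.trans hup)
    | succ n =>
      exact le_picard_zm hB hγ hgIR hb hlo (iterate_seqBox hgIR hgIRγ hb hlo n) m
  refine ⟨lt_of_lt_of_le (one_div_pos.mpr (Real.sqrt_pos.mpr hbb)) (ge_of_tendsto' ht hlow), ?_⟩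
  exact le_of_tendsto' ht fun n => (iterate_seqBox hgIR hgIRγ hb hlo n m).2

/-- THE LIMIT IS A FIXED POINT of the solution map. [folklore] -/
theorem picard_solution_zm
    (hB : ∀ u u' : ℕ → ℝ, SeqBox γ u → SeqBox γ u' → ∀ D : ℝ, (∀ j, |u j - u' j| ≤ D) → |B u - B u'| ≤ M * D)
    (hM : 0 ≤ M) (hgIR : 0 < gIR) (hgIRγ : gIR ≤ γ) (hb : 0 < b) (hlo : ∀ u, SeqBox γ u → b ≤ B u)
    (hsmall : M * γ < b) : picard B gIR (solution B gIR) = solution B gIR := by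
  have hγ : 0 < γ := lt_of_lt_of_le hgIR hgIRγ
  set q := M * γ / b with hq
  have hq0 : 0 ≤ q := contraction_const_nonneg_zm hM hγ.le hb
  have hq1 : q < 1 := contraction_const_lt_one_zm hb hsmall
  have hsol := solution_seqBox_zm hB hM hgIR hgIRγ hb hlo hsmall
  funext m
  have h1 : Tendsto (fun n => iterate B gIR (n + 1) m) atTop (𝓝 (picard B gIR (solution B gIR) m)) := by
    refine tendsto_of_abs_sub_le_geom (c := q * (γ / (1 - q))) hq0 hq1 fun n => ?_
    have hD : ∀ i, |iterate B gIR n i - solution B gIR i| ≤ γ * q ^ n / (1 - q) := fun i =>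
      abs_iterate_sub_solution_le_zm hB hM hgIR hgIRγ hb hlo hsmall n i
    have := picard_contraction_zm hB hM hgIR hgIRγ hb hlo (iterate_seqBox hgIR hgIRγ hb hlo n) hsol hD m
    calc |iterate B gIR (n + 1) m - picard B gIR (solution B gIR) m|
        = |picard B gIR (iterate B gIR n) m - picard B gIR (solution B gIR) m| := rfl
      _ ≤ q * (γ * q ^ n / (1 - q)) := this
      _ = q * (γ / (1 - q)) * q ^ n := by ring
  have h2 : Tendsto (fun n => iterate B gIR (n + 1) m) atTop (𝓝 (solution B gIR m)) :=
    (tendsto_iterate_zm hB hM hgIR hgIRγ hb hlo hsmall m).comp (tendsto_add_atTop_nat 1)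
  exact tendsto_nhds_unique h1 h2

/-- **EXISTENCE UNDER THE ZEROTH MOMENT**: under `M·γ < b` the limit of the Picard iterates is a box solution from `gIR`. [folklore] -/
theorem memFlow_solution_zm
    (hB : ∀ u u' : ℕ → ℝ, SeqBox γ u → SeqBox γ u' → ∀ D : ℝ, (∀ j, |u j - u' j| ≤ D) → |B u - B u'| ≤ M * D)
    (hM : 0 ≤ M) (hgIR : 0 < gIR) (hgIRγ : gIR ≤ γ) (hb : 0 < b) (hlo : ∀ u, SeqBox γ u → b ≤ B u)
    (hsmall : M * γ < b) : MemFlow B gIR (solution B gIR) :=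
  memFlow_of_picard_eq hgIR hb hlo (solution_seqBox_zm hB hM hgIR hgIRγ hb hlo hsmall)
    (picard_solution_zm hB hM hgIR hgIRγ hb hlo hsmall)

/-- **WELL-POSEDNESS UNDER THE ZEROTH MOMENT**: exactly one box solution per pin `gIR ∈ ]0,γ]`. [folklore] -/
theorem existsUnique_memFlow_zm
    (hB : ∀ u u' : ℕ → ℝ, SeqBox γ u → SeqBox γ u' → ∀ D : ℝ, (∀ j, |u j - u' j| ≤ D) → |B u - B u'| ≤ M * D)
    (hM : 0 ≤ M) (hgIR : 0 < gIR) (hgIRγ : gIR ≤ γ) (hb : 0 < b) (hlo : ∀ u, SeqBox γ u → b ≤ B u)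
    (hsmall : M * γ < b) : ∃! h : ℕ → ℝ, SeqBox γ h ∧ MemFlow B gIR h :=
  ⟨solution B gIR, ⟨solution_seqBox_zm hB hM hgIR hgIRγ hb hlo hsmall, memFlow_solution_zm hB hM hgIR hgIRγ hb hlo hsmall⟩,
    fun _ hh => memFlow_unique_zm hB hM hgIR hgIRγ hb hlo hsmall hh.1 (solution_seqBox_zm hB hM hgIR hgIRγ hb hlo hsmall)
      hh.2 (memFlow_solution_zm hB hM hgIR hgIRγ hb hlo hsmall)⟩

/-- Any box solution IS the constructed one. [folklore] -/
theorem eq_solution_of_memFlow_zm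
    (hB : ∀ u u' : ℕ → ℝ, SeqBox γ u → SeqBox γ u' → ∀ D : ℝ, (∀ j, |u j - u' j| ≤ D) → |B u - B u'| ≤ M * D)
    (hM : 0 ≤ M) (hgIR : 0 < gIR) (hgIRγ : gIR ≤ γ) (hb : 0 < b) (hlo : ∀ u, SeqBox γ u → b ≤ B u)
    (hsmall : M * γ < b) (hh : SeqBox γ h) (hf : MemFlow B gIR h) : h = solution B gIR :=
  memFlow_unique_zm hB hM hgIR hgIRγ hb hlo hsmall hh (solution_seqBox_zm hB hM hgIR hgIRγ hb hlo hsmall) hf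
    (memFlow_solution_zm hB hM hgIR hgIRγ hb hlo hsmall)

/-! ## §4 Node U2's geometric memory profile is the special case `M = Cm∕(1−θ)` -/

/-- `MemoryProfile Cm θ γ B` (`0 ≤ Cm`, `0 ≤ θ < 1`) IMPLIES the zeroth-moment hypothesis with `M = Cm∕(1−θ)` (node U2's
`abs_sub_shift_le` at shift `0`): everything above applies to node U2's class with `q = Cm·γ∕(b(1−θ))` — its `hsmall`. [folklore] -/
theorem zerothMoment_of_memoryProfile {Cm θ : ℝ} (hBp : MemoryProfile Cm θ γ B) (hCm : 0 ≤ Cm) (hθ0 : 0 ≤ θ)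
    (hθ1 : θ < 1) :
    ∀ u u' : ℕ → ℝ, SeqBox γ u → SeqBox γ u' → ∀ D : ℝ, (∀ j, |u j - u' j| ≤ D) → |B u - B u'| ≤ Cm / (1 - θ) * D := by
  intro u u' hu hu' D hD
  have h := abs_sub_shift_le hBp hCm hθ0 hθ1 hu hu' hD 0
  simp only [Nat.zero_add] at h
  calc |B u - B u'| = |B (fun j => u j) - B (fun j => u' j)| := rfl
    _ ≤ Cm * (D / (1 - θ)) := h
    _ = Cm / (1 - θ) * D := by ring

end Summit.QuantumFields.BalabanUV.Beta.EriceRemainderEnclosureHistoryAutonomyWellPosed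

end
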